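import Literature.MathematicalPhysics.QuantumFieldTheory.Balaban1983to89.B1Eq324BenfattoKernelComparison
import Literature.MathematicalPhysics.QuantumFieldTheory.Balaban1983to89.B1Eq324BenfattoClassDecouplingExtensive
import HarnessLib

/-!
# `Balaban1983to89.B1Eq324BenfattoKernelComparisonExtensive` — [BenfattoEtAl1978] §5 (5.13) p. 155 for the class of
# [Balaban1985BackgroundPropagators] Sect. E p. 428, |I|-EXTENSIVE form: seat n08-b's `decoupling_extensive` (block-diagonal precision shifted
# by the DIAGONAL of the cross row sums, prefactor `e^{±Σ_y r_y/(γ − r_max)}`) DELIVERED ON THE CONDITIONED FIELD the §5 chain integrates against,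
# and the factorisation of its comparison field, PROVED

statement-level skeleton of published theorems with citation tags; proofs where landed; nothing here is a claim about the
Yang–Mills mass gap

WHY THIS MODULE (cell `pub-ymgap`, seat `dag-n08-d` gen 11, sequel of `…KernelComparison` (J2, p599067); node N08 [Balaban1985UV3]; the
[BenfattoEtAl1978] source chain behind the (α)-row `h324`).  J2 §3 transports n08-b's SCALAR decoupling (`…ClassDecoupling.decoupling`,
comparison precisions `(1∓δ)B_bd`) whose prefactor `((1+δ)/(1−δ))^{|Λ∖Γ|/2}` is extensive in the VOLUME of the free region (referee ref-G READ283
NOTE-1: a (5.13) substitute only for `δ ≲ 1/|Λ∖Γ|`).  n08-b's `…ClassDecouplingExtensive.decoupling_extensive` removes that: the cross part of the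
conditional precision `B = A|_{Λ∖Γ}` is sandwiched by the diagonal form of its cross row sums `r`, `B_bd − diag r ≤ B ≤ B_bd + diag r`, and the
two normalisations differ by at most `e^{ρ}`, `ρ = Σ_y r_y/(γ − r_max)` — extensive in the CROSS MASS, carried by the corridor-adjacent sites.  This
file is the measure-level twin of J2 §3–§4 for that estimate: the conditioned class field `P̄^K_{Γ,z̄}` (the recipe of `…KernelCondField` at the
zero-extended kernel of `…KernelOfPrecision`) against the shifted Gaussian field of ANY positive-semidefinite kernel whose Gram matrix on `Λ ∖ Γ` is
`(B_bd ∓ diag r)⁻¹`, with the SAME centre `u_Γ(z̄)`; and that comparison field factorises over the boxes.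

WHAT IS PROVED (standard axioms; no `sorry`; no definition).  Setting of `…KernelOfPrecision`: `Λ ⊂ Q₀` finite, `A : Matrix Λ Λ ℝ` symmetric and
`γ`-coercive, `hK : K x y = [x,y∈Λ]·(A⁻¹)_{xy}`, corridors `Γ ⊆ Λ`, a partition `π` of `↥(Λ ∖ Γ)`, cross-row-sum bounds `r` with `r ≤ r_max < γ`.
* §1 (private) the translate of n08-b's centred conclusions to a common mean (translate the observable; `multivariateGaussian_eq_map_add`).
* §2 ★★★ `lintegral_restrict_condFieldK_le_blockDiagDiag` / `lintegral_restrict_condFieldK_ge_blockDiagDiag` — for every measurable `F ≥ 0` of the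
  `Λ ∖ Γ`-coordinates and every PSD kernel `K₂` with `covGram K₂ (Λ∖Γ) = ((A|_{Λ∖Γ})_bd ∓ diag r)⁻¹`:
  `∫⁻ F dP̄^K_{Γ,z̄} ≤ e^{ρ} ∫⁻ F d[𝒩(0,K₂)∘(u_Γ(z̄)+·)⁻¹]` and `e^{−ρ} ∫⁻ F d[𝒩(0,K₂)∘(u_Γ(z̄)+·)⁻¹] ≤ ∫⁻ F dP̄^K_{Γ,z̄}` (`decoupling_extensive` conjuncts 4–5 +
  J2 §1 + J1's Dirichlet Gram identity).
* §3 `kernel_blockDiagDiag_eq_zero_of_ne` — the zero-extended kernel of `B_bd + c·diag r` vanishes across the parts (n08-b's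
  `inv_blockDiag_add_smul_diagonal_apply_eq_zero`), so J2's `iIndepFun_shift_of_kernel_eq_zero` / `integral_prod_eq_prod_integral_shift` give the
  factorisation of the comparison field over the boxes.
HONEST SCOPE.  Transport and assembly only — the estimate is seat n08-b's; the class and the substitute for (5.13) are OUR reading of
[Balaban1985BackgroundPropagators] p. 428 for [Balaban1982Higgs1] p. 616, not print; nothing of [Balaban1985UV3] / [Balaban1985UV2] is asserted; no
generalised Basic Lemma is stated; count-neutral for N08; nothing about d = 4, the continuum, OS axioms, a mass gap or the Clay problem.
-/

noncomputable section

open MeasureTheory ProbabilityTheory Finset Matrix WithLp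
open scoped BigOperators Matrix NNReal ENNReal

namespace Literature.MathematicalPhysics.QuantumFieldTheory.Balaban1983to89.B1Eq324BenfattoKernelComparisonExtensive

open Literature.MathematicalPhysics.QuantumFieldTheory
open Literature.MathematicalPhysics.QuantumFieldTheory.Balaban1983to89.B1Eq324BenfattoLemma
open Literature.MathematicalPhysics.QuantumFieldTheory.Balaban1983to89.B1Eq324BenfattoKernelRegression
open Literature.MathematicalPhysics.QuantumFieldTheory.Balaban1983to89.B1Eq324BenfattoKernelOfPrecision
open Literature.MathematicalPhysics.QuantumFieldTheory.Balaban1983to89.B1Eq324BenfattoKernelComparison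
open Literature.MathematicalPhysics.QuantumFieldTheory.Balaban1983to89.B1Eq324BenfattoClassAppendixC
open Literature.MathematicalPhysics.QuantumFieldTheory.Balaban1983to89.B1Eq324BenfattoClassDecoupling
open Literature.MathematicalPhysics.QuantumFieldTheory.Balaban1983to89.B1Eq324BenfattoClassDecouplingExtensive

variable {d : ℕ}

/-! ## §1  Translating n08-b's centred domination to a common mean (private plumbing) -/

section Translate

variable {m : Type*} [Fintype m] [DecidableEq m]

/-- kernel: an upper domination between centred Gaussians transfers to a common mean (translate the observable). [folklore] -/
private theorem lintegral_mean_le_of_centred {P₁ P₂ : Matrix m m ℝ} {c : ℝ≥0∞}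
    (h : ∀ (G : EuclideanSpace ℝ m → ℝ≥0∞), Measurable G →
      ∫⁻ y, G y ∂(multivariateGaussian 0 P₁⁻¹) ≤ c * ∫⁻ y, G y ∂(multivariateGaussian 0 P₂⁻¹))
    (mu : EuclideanSpace ℝ m) {F : EuclideanSpace ℝ m → ℝ≥0∞} (hF : Measurable F) :
    ∫⁻ y, F y ∂(multivariateGaussian mu P₁⁻¹) ≤ c * ∫⁻ y, F y ∂(multivariateGaussian mu P₂⁻¹) := by
  rw [multivariateGaussian_eq_map_add mu P₁⁻¹, multivariateGaussian_eq_map_add mu P₂⁻¹,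
    lintegral_map hF (measurable_const_add mu), lintegral_map hF (measurable_const_add mu)]
  exact h (fun y => F (mu + y)) (hF.comp (measurable_const_add mu))

/-- kernel: a lower domination between centred Gaussians transfers to a common mean. [folklore] -/
private theorem lintegral_mean_ge_of_centred {P₁ P₂ : Matrix m m ℝ} {c : ℝ≥0∞}
    (h : ∀ (G : EuclideanSpace ℝ m → ℝ≥0∞), Measurable G →
      c * ∫⁻ y, G y ∂(multivariateGaussian 0 P₂⁻¹) ≤ ∫⁻ y, G y ∂(multivariateGaussian 0 P₁⁻¹))
    (mu : EuclideanSpace ℝ m) {F : EuclideanSpace ℝ m → ℝ≥0∞} (hF : Measurable F) :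
    c * ∫⁻ y, F y ∂(multivariateGaussian mu P₂⁻¹) ≤ ∫⁻ y, F y ∂(multivariateGaussian mu P₁⁻¹) := by
  rw [multivariateGaussian_eq_map_add mu P₁⁻¹, multivariateGaussian_eq_map_add mu P₂⁻¹,
    lintegral_map hF (measurable_const_add mu), lintegral_map hF (measurable_const_add mu)]
  exact h (fun y => F (mu + y)) (hF.comp (measurable_const_add mu))

end Translate

/-! ## §2  The |I|-extensive decoupling estimate on the conditioned class field -/

section PrecisionClass

variable {Λ : Finset (B1Eq324BenfattoLemma.Site d)} {A : Matrix Λ Λ ℝ}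
  {K : B1Eq324BenfattoLemma.Site d → B1Eq324BenfattoLemma.Site d → ℝ}
  (hK : ∀ x y, K x y = if h : x ∈ Λ ∧ y ∈ Λ then (A⁻¹ : Matrix Λ Λ ℝ) ⟨x, h.1⟩ ⟨y, h.2⟩ else 0)

include hK

/-- **THE |I|-EXTENSIVE DECOUPLING ESTIMATE ON THE CONDITIONED CLASS FIELD, upper.**  Setting: the class kernel `K` of a symmetric
`γ`-coercive precision `A` on `Λ`; corridors `Γ ⊆ Λ`; a partition `π` of `Λ ∖ Γ` («boxes»); cross-row-sum bounds
`Σ_{π y′ ≠ π y} |A_{yy′}| ≤ r_y ≤ r_max < γ` on `Λ ∖ Γ`; `ρ := (Σ_y r_y)/(γ − r_max)`; and ANY positive-semidefinite comparison kernel `K₂` whose Gram matrix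
on `Λ ∖ Γ` is `((A|_{Λ∖Γ})_bd − diag r)⁻¹`.  Then for every measurable `F ≥ 0` of the `Λ ∖ Γ`-coordinates
`∫⁻ F dP̄^K_{Γ,z̄} ≤ e^{ρ} ∫⁻ F d[𝒩(0,K₂) ∘ (u_Γ(z̄) + ·)⁻¹]` — n08-b's `decoupling_extensive` (fifth conclusion) translated to the common centre `u_Γ(z̄)` and
read on the fields through `…KernelComparison` §1 and `…KernelOfPrecision.covGram_condCov_kernel_eq_inv_submatrix`.  The prefactor is extensive in the
CROSS MASS `Σ_y r_y`, not in `|Λ ∖ Γ|`. [cite: BenfattoEtAl1978, §5 (5.13) p.155, (5.36) p.159 (class substitute, extensive form; ours)] -/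
theorem lintegral_restrict_condFieldK_le_blockDiagDiag {σ : Type*} [Fintype σ] [DecidableEq σ]
    (hAs : ∀ e e', A e e' = A e' e) {γ rmax : ℝ} (hγ0 : 0 < γ)
    (hγ : ∀ x : Λ → ℝ, γ * ∑ e, x e ^ 2 ≤ ∑ e, ∑ e', A e e' * x e * x e')
    {Γ : Finset (B1Eq324BenfattoLemma.Site d)} (hΓ : Γ ⊆ Λ) (π : ↥(Λ \ Γ) → σ) (r : ↥(Λ \ Γ) → ℝ)
    (hr : ∀ y : ↥(Λ \ Γ), ∑ y' : ↥(Λ \ Γ), (if π y = π y' then (0 : ℝ) else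
      |A ⟨y, (Finset.mem_sdiff.mp y.2).1⟩ ⟨y', (Finset.mem_sdiff.mp y'.2).1⟩|) ≤ r y)
    (hrmax : ∀ y, r y ≤ rmax) (hγr : rmax < γ) (zbar : B1Eq324BenfattoLemma.Site d → ℝ)
    {K₂ : B1Eq324BenfattoLemma.Site d → B1Eq324BenfattoLemma.Site d → ℝ} (hK₂ : IsPosSemidefKernel K₂)
    (h₂ : covGram K₂ (Λ \ Γ) = ((Matrix.of fun y y' : ↥(Λ \ Γ) => if π y = π y' then
        A ⟨y, (Finset.mem_sdiff.mp y.2).1⟩ ⟨y', (Finset.mem_sdiff.mp y'.2).1⟩ else 0) - Matrix.diagonal r)⁻¹)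
    {F : (↥(Λ \ Γ) → ℝ) → ℝ≥0∞} (hF : Measurable F) :
    ∫⁻ z, F ((Λ \ Γ).restrict z) ∂((gaussianFieldOfKernel (condCov K Γ)).map
        fun (ζ : B1Eq324BenfattoLemma.Site d → ℝ) (x : B1Eq324BenfattoLemma.Site d) => condMean K Γ zbar x + ζ x) ≤
      ENNReal.ofReal (Real.exp ((∑ y, r y) / (γ - rmax))) *
        ∫⁻ z, F ((Λ \ Γ).restrict z) ∂((gaussianFieldOfKernel K₂).map
          fun (ζ : B1Eq324BenfattoLemma.Site d → ℝ) (x : B1Eq324BenfattoLemma.Site d) => condMean K Γ zbar x + ζ x) := by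
  classical
  set B : Matrix ↥(Λ \ Γ) ↥(Λ \ Γ) ℝ := A.submatrix (fun j : ↥(Λ \ Γ) => (⟨j, (Finset.mem_sdiff.mp j.2).1⟩ : Λ))
    (fun j : ↥(Λ \ Γ) => (⟨j, (Finset.mem_sdiff.mp j.2).1⟩ : Λ)) with hB
  have hBs : ∀ y y', B y y' = B y' y := fun y y' => hAs _ _
  have hBγ : ∀ v : ↥(Λ \ Γ) → ℝ, γ * ∑ y, v y ^ 2 ≤ ∑ y, ∑ y', B y y' * v y * v y' := coercive_submatrix_sdiff hγ Γ
  have hrB : ∀ y : ↥(Λ \ Γ), ∑ y' : ↥(Λ \ Γ), (if π y = π y' then (0 : ℝ) else |B y y'|) ≤ r y := fun y => by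
    simpa only [hB, Matrix.submatrix_apply] using hr y
  have hA : A.PosDef := posDef_of_coercive hAs hγ0 hγ
  have hdetΓ : IsUnit (covGram K Γ).det := isUnit_det_covGram_kernel hK hA hΓ
  have hKc : IsPosSemidefKernel (condCov K Γ) := isPosSemidefKernel_condCov K (isPosSemidefKernel_kernel hK hA) Γ hdetΓ
  have h₁ : covGram (condCov K Γ) (Λ \ Γ) = B⁻¹ := covGram_condCov_kernel_eq_inv_submatrix hK hA hΓ
  have hBbd : (Matrix.of fun y y' : ↥(Λ \ Γ) => if π y = π y' then
        A ⟨y, (Finset.mem_sdiff.mp y.2).1⟩ ⟨y', (Finset.mem_sdiff.mp y'.2).1⟩ else 0) =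
      (Matrix.of fun y y' : ↥(Λ \ Γ) => if π y = π y' then B y y' else 0 : Matrix ↥(Λ \ Γ) ↥(Λ \ Γ) ℝ) := by
    ext y y'
    simp only [Matrix.of_apply, hB, Matrix.submatrix_apply]
  rw [hBbd] at h₂
  have hofLp : Measurable (ofLp : EuclideanSpace ℝ ↥(Λ \ Γ) → (↥(Λ \ Γ) → ℝ)) :=
    (MeasurableEquiv.toLp 2 (↥(Λ \ Γ) → ℝ)).symm.measurable
  -- n08-b's centred conclusion (5), for every observable
  have hdec : ∀ (G : EuclideanSpace ℝ ↥(Λ \ Γ) → ℝ≥0∞), Measurable G →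
      ∫⁻ y, G y ∂(multivariateGaussian 0 B⁻¹) ≤ ENNReal.ofReal (Real.exp ((∑ y, r y) / (γ - rmax))) *
        ∫⁻ y, G y ∂(multivariateGaussian 0
          ((Matrix.of fun y y' : ↥(Λ \ Γ) => if π y = π y' then B y y' else 0 : Matrix ↥(Λ \ Γ) ↥(Λ \ Γ) ℝ) -
            Matrix.diagonal r)⁻¹) :=
    fun G hG => (decoupling_extensive hBs π r hBγ hrB hrmax hγr G hG).2.2.2.2
  rw [lintegral_comp_restrict_shift_eq hKc (condMean K Γ zbar) (Λ \ Γ) hF,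
    lintegral_comp_restrict_shift_eq hK₂ (condMean K Γ zbar) (Λ \ Γ) hF, h₁, h₂]
  exact lintegral_mean_le_of_centred hdec _ (hF.comp hofLp)

/-- **THE |I|-EXTENSIVE DECOUPLING ESTIMATE ON THE CONDITIONED CLASS FIELD, lower**: with the comparison Gram matrix
`((A|_{Λ∖Γ})_bd + diag r)⁻¹`, `e^{−ρ} ∫⁻ F d[𝒩(0,K₂) ∘ (u_Γ(z̄) + ·)⁻¹] ≤ ∫⁻ F dP̄^K_{Γ,z̄}`.
[cite: BenfattoEtAl1978, §5 (5.13) p.155, (5.36) p.159 (class substitute, extensive form; ours)] -/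
theorem lintegral_restrict_condFieldK_ge_blockDiagDiag {σ : Type*} [Fintype σ] [DecidableEq σ]
    (hAs : ∀ e e', A e e' = A e' e) {γ rmax : ℝ} (hγ0 : 0 < γ)
    (hγ : ∀ x : Λ → ℝ, γ * ∑ e, x e ^ 2 ≤ ∑ e, ∑ e', A e e' * x e * x e')
    {Γ : Finset (B1Eq324BenfattoLemma.Site d)} (hΓ : Γ ⊆ Λ) (π : ↥(Λ \ Γ) → σ) (r : ↥(Λ \ Γ) → ℝ)
    (hr : ∀ y : ↥(Λ \ Γ), ∑ y' : ↥(Λ \ Γ), (if π y = π y' then (0 : ℝ) else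
      |A ⟨y, (Finset.mem_sdiff.mp y.2).1⟩ ⟨y', (Finset.mem_sdiff.mp y'.2).1⟩|) ≤ r y)
    (hrmax : ∀ y, r y ≤ rmax) (hγr : rmax < γ) (zbar : B1Eq324BenfattoLemma.Site d → ℝ)
    {K₂ : B1Eq324BenfattoLemma.Site d → B1Eq324BenfattoLemma.Site d → ℝ} (hK₂ : IsPosSemidefKernel K₂)
    (h₂ : covGram K₂ (Λ \ Γ) = ((Matrix.of fun y y' : ↥(Λ \ Γ) => if π y = π y' then
        A ⟨y, (Finset.mem_sdiff.mp y.2).1⟩ ⟨y', (Finset.mem_sdiff.mp y'.2).1⟩ else 0) + Matrix.diagonal r)⁻¹)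
    {F : (↥(Λ \ Γ) → ℝ) → ℝ≥0∞} (hF : Measurable F) :
    ENNReal.ofReal (Real.exp (-((∑ y, r y) / (γ - rmax)))) *
        ∫⁻ z, F ((Λ \ Γ).restrict z) ∂((gaussianFieldOfKernel K₂).map
          fun (ζ : B1Eq324BenfattoLemma.Site d → ℝ) (x : B1Eq324BenfattoLemma.Site d) => condMean K Γ zbar x + ζ x) ≤
      ∫⁻ z, F ((Λ \ Γ).restrict z) ∂((gaussianFieldOfKernel (condCov K Γ)).map
        fun (ζ : B1Eq324BenfattoLemma.Site d → ℝ) (x : B1Eq324BenfattoLemma.Site d) => condMean K Γ zbar x + ζ x) := by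
  classical
  set B : Matrix ↥(Λ \ Γ) ↥(Λ \ Γ) ℝ := A.submatrix (fun j : ↥(Λ \ Γ) => (⟨j, (Finset.mem_sdiff.mp j.2).1⟩ : Λ))
    (fun j : ↥(Λ \ Γ) => (⟨j, (Finset.mem_sdiff.mp j.2).1⟩ : Λ)) with hB
  have hBs : ∀ y y', B y y' = B y' y := fun y y' => hAs _ _
  have hBγ : ∀ v : ↥(Λ \ Γ) → ℝ, γ * ∑ y, v y ^ 2 ≤ ∑ y, ∑ y', B y y' * v y * v y' := coercive_submatrix_sdiff hγ Γ
  have hrB : ∀ y : ↥(Λ \ Γ), ∑ y' : ↥(Λ \ Γ), (if π y = π y' then (0 : ℝ) else |B y y'|) ≤ r y := fun y => by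
    simpa only [hB, Matrix.submatrix_apply] using hr y
  have hA : A.PosDef := posDef_of_coercive hAs hγ0 hγ
  have hdetΓ : IsUnit (covGram K Γ).det := isUnit_det_covGram_kernel hK hA hΓ
  have hKc : IsPosSemidefKernel (condCov K Γ) := isPosSemidefKernel_condCov K (isPosSemidefKernel_kernel hK hA) Γ hdetΓ
  have h₁ : covGram (condCov K Γ) (Λ \ Γ) = B⁻¹ := covGram_condCov_kernel_eq_inv_submatrix hK hA hΓ
  have hBbd : (Matrix.of fun y y' : ↥(Λ \ Γ) => if π y = π y' then
        A ⟨y, (Finset.mem_sdiff.mp y.2).1⟩ ⟨y', (Finset.mem_sdiff.mp y'.2).1⟩ else 0) =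
      (Matrix.of fun y y' : ↥(Λ \ Γ) => if π y = π y' then B y y' else 0 : Matrix ↥(Λ \ Γ) ↥(Λ \ Γ) ℝ) := by
    ext y y'
    simp only [Matrix.of_apply, hB, Matrix.submatrix_apply]
  rw [hBbd] at h₂
  have hofLp : Measurable (ofLp : EuclideanSpace ℝ ↥(Λ \ Γ) → (↥(Λ \ Γ) → ℝ)) :=
    (MeasurableEquiv.toLp 2 (↥(Λ \ Γ) → ℝ)).symm.measurable
  -- n08-b's centred conclusion (4), for every observable
  have hdec : ∀ (G : EuclideanSpace ℝ ↥(Λ \ Γ) → ℝ≥0∞), Measurable G →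
      ENNReal.ofReal (Real.exp (-((∑ y, r y) / (γ - rmax)))) *
        ∫⁻ y, G y ∂(multivariateGaussian 0
          ((Matrix.of fun y y' : ↥(Λ \ Γ) => if π y = π y' then B y y' else 0 : Matrix ↥(Λ \ Γ) ↥(Λ \ Γ) ℝ) +
            Matrix.diagonal r)⁻¹) ≤ ∫⁻ y, G y ∂(multivariateGaussian 0 B⁻¹) :=
    fun G hG => (decoupling_extensive hBs π r hBγ hrB hrmax hγr G hG).2.2.2.1
  rw [lintegral_comp_restrict_shift_eq hKc (condMean K Γ zbar) (Λ \ Γ) hF,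
    lintegral_comp_restrict_shift_eq hK₂ (condMean K Γ zbar) (Λ \ Γ) hF, h₁, h₂]
  exact lintegral_mean_ge_of_centred hdec _ (hF.comp hofLp)

end PrecisionClass

/-! ## §3  The comparison field factorises over the boxes -/

section Factorisation

variable {Λ' : Finset (B1Eq324BenfattoLemma.Site d)} {P : Matrix Λ' Λ' ℝ}
  {K₂ : B1Eq324BenfattoLemma.Site d → B1Eq324BenfattoLemma.Site d → ℝ}
  (hK₂ : ∀ x y, K₂ x y = if h : x ∈ Λ' ∧ y ∈ Λ' then (P⁻¹ : Matrix Λ' Λ' ℝ) ⟨x, h.1⟩ ⟨y, h.2⟩ else 0)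

include hK₂

/-- **THE EXTENSIVE COMPARISON FIELD DECOUPLES THE BOXES**: for the zero-extended kernel `K₂` of a positive-definite precision
`P = B_bd + c·diag r` (`B_bd` block-diagonal along `π`), `K₂ s t = 0` whenever `s`, `t` lie in different parts (n08-b's
`inv_blockDiag_add_smul_diagonal_apply_eq_zero`) or off `Λ′` — so `…KernelComparison.iIndepFun_shift_of_kernel_eq_zero` /
`integral_prod_eq_prod_integral_shift` apply with `Ω_i = π⁻¹{i}`: the dominating measures of §2 are products over the boxes («the integral
factorizes», (5.13)). [cite: BenfattoEtAl1978, §5 (5.13) p.155 (class substitute, extensive form; ours)] -/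
theorem kernel_blockDiagDiag_eq_zero_of_ne {σ : Type*} [Fintype σ] [DecidableEq σ] (B : Matrix Λ' Λ' ℝ) (π : Λ' → σ)
    (r : Λ' → ℝ) (c : ℝ)
    (hP : P = (Matrix.of fun a b => if π a = π b then B a b else 0 : Matrix Λ' Λ' ℝ) + c • Matrix.diagonal r) (hPD : P.PosDef)
    {s t : B1Eq324BenfattoLemma.Site d} (hst : ∀ (hs : s ∈ Λ') (ht : t ∈ Λ'), π ⟨s, hs⟩ ≠ π ⟨t, ht⟩) : K₂ s t = 0 := by
  by_cases hs : s ∈ Λ'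
  · by_cases ht : t ∈ Λ'
    · rw [hK₂, dif_pos ⟨hs, ht⟩, hP]
      rw [hP] at hPD
      exact inv_blockDiag_add_smul_diagonal_apply_eq_zero π r c hPD (hst hs ht)
    · rw [hK₂, dif_neg fun h => ht h.2]
  · rw [hK₂, dif_neg fun h => hs h.1]

end Factorisation

end Literature.MathematicalPhysics.QuantumFieldTheory.Balaban1983to89.B1Eq324BenfattoKernelComparisonExtensive

end
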